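import Mathlib
import Literature.MathematicalPhysics.QuantumLattice.LindhardEllipticClosedForm
import HarnessLib

/-!
# The square-lattice `s`-representation at its fold, I: amplitudes, sheet functions, elliptic parameters

# Route `WeakCouplingBCS` — certificate half of stmt-HubbardSuperconductivity-0158 (t′ = 0 enclosure discharge, crux-idea «caustic-closed-form-row»).

Cell `gate-hubbard-kl`; filed by prover seat p4 g25 (pen (R511)(A)) under `Summits/…/Theorems/` — RE-HOMED from the planner's
Literature-shaped turnkey (`Literature/MathematicalPhysics/QuantumLattice/LindhardSRepFold*.lean`, hubbard-klscan-idea-4 g13 r13 split/,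
sha16 0f1ee556fe6ef09b) because the gate's `lint.literature-cited-only` admits `[folklore]` only on private helpers and these fold
expansions are the cell's own analysis («new results belong under Summits/<Summit>/»); namespace `Summit.HubbardSuperconductivity.HubbardSuperconductivity.Theorems`
with `open Literature.MathematicalPhysics.QuantumLattice`; statements and proofs byte-identical to the turnkey.
 Companion of `LindhardEllipticClosedForm.lean`
(`lindhardFunction_squareDispersion_eq_integral_anisoDOSMass`:
`χ₀(q; μ) = (2π)⁻² ∫₀¹ anisoDOSMass μ (A₀ s) (A₁ s) ds`, `Aᵢ(s) = √(1 − 4s(1−s) sin²(qᵢ/2))`). Elementary facts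
about the integrand that organise the `2k_F` (Kohn) geometry of `χ₀` (sequels: `WeakCouplingBCSKlLindhardSRepFoldLog.lean`,
`WeakCouplingBCSKlLindhardSRepFoldExpansion.lean`):

* (a) `sRepAmp S s = √(1 − 4s(1−s)S)` has the exact FOLD FORM `√((1−S) + 4S(s−½)²)` (`sRepAmp_eq_fold`),
  is symmetric under `s ↦ 1−s`, minimal at `s = ½` with value `√(1−S)` (`= |cos(qᵢ/2)|` for
  `S = sin²(qᵢ/2)`, `sRepAmp_half_sin_sq`), and admits the two-sided expansion
  `c(1 + t/2 − t²/8) ≤ A ≤ c(1 + t/2)`, `c = √(1−S)`, `t = 4S(s−½)²/c²` (`sRepAmp_fold_two_sided`);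
* (b) the SHEET FUNCTIONS `kohnSheet μ q s = 4(A₁−A₀)² − μ²` (van Hove / Kohn sheet) and
  `edgeSheet μ q s = 4(A₀+A₁)² − μ²` (band edge), their fold values `kohnSheetFold`, `edgeSheetFold`
  (`4(|cos(q₁/2)| ∓ |cos(q₀/2)|)² − μ²`), the symmetry `s ↦ 1 − s`, and `edgeSheetFold_le_edgeSheet`
  (the band-edge function is minimal at the fold);
* (c) `one_sub_innerParam : 1 − 16ab/P = X/P`, `one_sub_outerParam : 1 − P/(16ab) = −X/(16ab)`
  (`X = 4(a−b)² − μ²`, `P = 4(a+b)² − μ²`): the complementary elliptic parameters of the two DOS branches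
  in sheet coordinates;
* the ridge-line clearance predicate `RidgeClear η q : ∀ i, η ≤ |cos(qᵢ/2)|`.

Provenance: cell gate-hubbard-kl, planner seat hubbard-klscan-idea-4 g13, §11 of the crux-idea sketch
«caustic-closed-form-row» on stmt-HubbardSuperconductivity-0158 (the certified `κ` of its model integrals).

## References
* [RaghuKivelsonScalapino2010] S. Raghu, S. A. Kivelson, D. J. Scalapino, Phys. Rev. B 81 (2010) 224505, §II (5)–(6)
  (the square-lattice Lindhard / DOS objects).
* Cell note CERT-SREP §1–§2 (gate-hubbard-kl, 2026), identity (I1) and the bounds (B1)–(B2).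
-/

noncomputable section

-- the tree's namespace `Summit.<Summit>.<Problem>.Theorems` repeats the summit name by design (D-0017)
set_option linter.dupNamespace false

open Real _root_.MeasureTheory _root_.Set
open Literature.Probability.RandomPlanarGeometry Literature.MathematicalPhysics.QuantumLattice

namespace Summit.HubbardSuperconductivity.HubbardSuperconductivity.Theorems

/-- Fold value of the van Hove (Kohn) sheet function: `X₀(q; μ) = 4(|cos(q₁/2)| − |cos(q₀/2)|)² − μ²`.
[cite: RaghuKivelsonScalapino2010, §II (5)–(6)] -/
def kohnSheetFold (μ : ℝ) (q : Momentum) : ℝ :=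
  4 * (|Real.cos (q 1 / 2)| - |Real.cos (q 0 / 2)|) ^ 2 - μ ^ 2

/-- Fold value of the band-edge sheet function: `P₀(q; μ) = 4(|cos(q₀/2)| + |cos(q₁/2)|)² − μ²`.
[cite: RaghuKivelsonScalapino2010, §II (5)–(6)] -/
def edgeSheetFold (μ : ℝ) (q : Momentum) : ℝ :=
  4 * (|Real.cos (q 0 / 2)| + |Real.cos (q 1 / 2)|) ^ 2 - μ ^ 2

/-- Ridge-line clearance `|cos(qᵢ/2)| ≥ η` for both coordinates.
[cite: RaghuKivelsonScalapino2010, §II (5)–(6)] -/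
def RidgeClear (η : ℝ) (q : Momentum) : Prop :=
  ∀ i : Fin 2, η ≤ |Real.cos (q i / 2)|

/-! ### (a) The amplitude of the `s`-representation and its fold at `s = ½` -/

/-- `A(S; s) = √(1 − 4s(1−s)S)`, the amplitude of the tree's `s`-representation
(`lindhardFunction_squareDispersion_eq_integral_anisoDOSMass`, with `S = sin²(qᵢ/2)`).
[cite: RaghuKivelsonScalapino2010, §II (5)–(6)] -/
def sRepAmp (S s : ℝ) : ℝ := Real.sqrt (1 - 4 * s * (1 - s) * S)

/-- Exact fold form: `A(S; s) = √((1 − S) + 4S(s − ½)²)`.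
[cite: RaghuKivelsonScalapino2010, §II (5)–(6)] -/
theorem sRepAmp_eq_fold (S s : ℝ) : sRepAmp S s = Real.sqrt ((1 - S) + 4 * S * (s - 1 / 2) ^ 2) := by
  unfold sRepAmp; congr 1; ring

/-- The amplitude is symmetric under `s ↦ 1 − s`. [cite: RaghuKivelsonScalapino2010, §II (5)–(6)] -/
theorem sRepAmp_symm (S s : ℝ) : sRepAmp S (1 - s) = sRepAmp S s := by
  unfold sRepAmp; congr 1; ring

/-- The amplitude at the fold: `A(S; ½) = √(1 − S)`. [cite: RaghuKivelsonScalapino2010, §II (5)–(6)] -/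
theorem sRepAmp_half (S : ℝ) : sRepAmp S (1 / 2) = Real.sqrt (1 - S) := by
  unfold sRepAmp; congr 1; ring

/-- `1 − sin²(x) = cos²(x)`. [folklore] -/
theorem one_sub_sin_sq' (t : ℝ) : 1 - Real.sin t ^ 2 = Real.cos t ^ 2 := by
  have := Real.sin_sq_add_cos_sq t; linarith

/-- At the fold the amplitude is `|cos(qᵢ/2)|` — the `c`-coordinate of the card's sheet functions.
[cite: RaghuKivelsonScalapino2010, §II (5)–(6)] -/
theorem sRepAmp_half_sin_sq (t : ℝ) : sRepAmp (Real.sin (t / 2) ^ 2) (1 / 2) = |Real.cos (t / 2)| := by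
  rw [sRepAmp_half, one_sub_sin_sq', Real.sqrt_sq_eq_abs]

/-- The fold is the minimum of the amplitude (`S ≥ 0`).
[cite: RaghuKivelsonScalapino2010, §II (5)–(6)] -/
theorem sRepAmp_half_le {S : ℝ} (hS : 0 ≤ S) (s : ℝ) : sRepAmp S (1 / 2) ≤ sRepAmp S s := by
  rw [sRepAmp_eq_fold, sRepAmp_eq_fold]
  apply Real.sqrt_le_sqrt
  nlinarith [mul_nonneg hS (sq_nonneg (s - 1 / 2))]

/-- `1 + t/2 − t²/8 ≤ √(1+t) ≤ 1 + t/2` for `t ≥ 0`. [folklore] -/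
theorem sqrt_one_add_bounds {t : ℝ} (ht0 : 0 ≤ t) :
    1 + t / 2 - t ^ 2 / 8 ≤ Real.sqrt (1 + t) ∧ Real.sqrt (1 + t) ≤ 1 + t / 2 := by
  have hpos : 0 < 1 + t := by linarith
  set r := Real.sqrt (1 + t) with hr
  have hr2 : r ^ 2 = 1 + t := Real.sq_sqrt hpos.le
  have hr1 : 1 ≤ r := Real.one_le_sqrt.mpr (by linarith)
  have ht : t = r ^ 2 - 1 := by linarith
  rw [ht]
  constructor
  · have key : 1 + (r ^ 2 - 1) / 2 - (r ^ 2 - 1) ^ 2 / 8 - r = -((r - 1) ^ 3 * (r + 3) / 8) := by ring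
    have hnn : 0 ≤ (r - 1) ^ 3 * (r + 3) / 8 := by
      have : 0 ≤ (r - 1) ^ 3 := pow_nonneg (by linarith) 3
      positivity
    linarith
  · have key : 1 + (r ^ 2 - 1) / 2 - r = (r - 1) ^ 2 / 2 := by ring
    have hnn : 0 ≤ (r - 1) ^ 2 / 2 := by positivity
    linarith

/-- Factorised fold form `A(S; s) = c·√(1 + 4Sσ²/c²)`, `c = √(1−S)`, `σ = s − ½` (`S < 1`).
[cite: RaghuKivelsonScalapino2010, §II (5)–(6)] -/
theorem sRepAmp_eq_mul_sqrt {S : ℝ} (hS1 : S < 1) (s : ℝ) :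
    sRepAmp S s = Real.sqrt (1 - S) * Real.sqrt (1 + 4 * S * (s - 1 / 2) ^ 2 / (1 - S)) := by
  have hne : (1 - S) ≠ 0 := by linarith
  rw [sRepAmp_eq_fold, ← Real.sqrt_mul (by linarith : (0:ℝ) ≤ 1 - S)]
  congr 1
  field_simp

/-- **Two-sided fold expansion of the amplitude**: with `c = √(1−S)`, `t = 4S(s−½)²/(1−S)`,
`c(1 + t/2 − t²/8) ≤ A(S; s) ≤ c(1 + t/2)`, i.e. `A = c + (2S/c)σ² − O(σ⁴)` with explicit constants.
[cite: RaghuKivelsonScalapino2010, §II (5)–(6)] -/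
theorem sRepAmp_fold_two_sided {S : ℝ} (hS0 : 0 ≤ S) (hS1 : S < 1) (s : ℝ) :
    Real.sqrt (1 - S) * (1 + (4 * S * (s - 1 / 2) ^ 2 / (1 - S)) / 2 -
        (4 * S * (s - 1 / 2) ^ 2 / (1 - S)) ^ 2 / 8) ≤ sRepAmp S s ∧
      sRepAmp S s ≤ Real.sqrt (1 - S) * (1 + (4 * S * (s - 1 / 2) ^ 2 / (1 - S)) / 2) := by
  rw [sRepAmp_eq_mul_sqrt hS1]
  have hc : 0 ≤ Real.sqrt (1 - S) := Real.sqrt_nonneg _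
  have ht0 : 0 ≤ 4 * S * (s - 1 / 2) ^ 2 / (1 - S) :=
    div_nonneg (mul_nonneg (mul_nonneg (by norm_num) hS0) (sq_nonneg _)) (by linarith)
  obtain ⟨h1, h2⟩ := sqrt_one_add_bounds ht0
  exact ⟨mul_le_mul_of_nonneg_left h1 hc, mul_le_mul_of_nonneg_left h2 hc⟩

/-- The fold coefficients in closed form: with `Sᵢ = 1 − cᵢ²`, the `σ²`-coefficient `2Sᵢ/cᵢ` of `Aᵢ`
combines on the Kohn sheet function to `(1−c₁²)/c₁ − (1−c₀²)/c₀ = −(c₁−c₀)(1 + 1/(c₀c₁))`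
(so `X(s) = X₀ − κσ² + O(σ⁴)` with `κ = 16(c₁−c₀)²(1 + 1/(c₀c₁)) = 4μ²(1 + 1/(c₀c₁))` ON the sheet).
[folklore] -/
theorem kohn_fold_coeff {c₀ c₁ : ℝ} (h0 : c₀ ≠ 0) (h1 : c₁ ≠ 0) :
    (1 - c₁ ^ 2) / c₁ - (1 - c₀ ^ 2) / c₀ = -((c₁ - c₀) * (1 + 1 / (c₀ * c₁))) := by
  field_simp
  ring

/-- … and on the band-edge sheet function to `(1−c₀²)/c₀ + (1−c₁²)/c₁ > 0` for `0 < cᵢ < 1`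
(`P(s) = P₀ + κ′σ² + O(σ⁴)`, `κ′ = 16(c₀+c₁)((1−c₀²)/c₀ + (1−c₁²)/c₁) > 0`: a strict minimum).
[folklore] -/
theorem edge_fold_coeff_pos {c₀ c₁ : ℝ} (h0 : 0 < c₀) (h0' : c₀ < 1) (h1 : 0 < c₁) (h1' : c₁ < 1) :
    0 < (1 - c₀ ^ 2) / c₀ + (1 - c₁ ^ 2) / c₁ := by
  have ha : 0 < (1 - c₀ ^ 2) / c₀ := div_pos (by nlinarith) h0
  have hb : 0 < (1 - c₁ ^ 2) / c₁ := div_pos (by nlinarith) h1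
  linarith

/-! ### (b) The sheet functions along `s` and their fold values -/

/-- Kohn (van Hove) sheet function `X(q; μ; s) = 4(A₁(s) − A₀(s))² − μ²`.
[cite: RaghuKivelsonScalapino2010, §II (5)–(6)] -/
def kohnSheet (μ : ℝ) (q : Momentum) (s : ℝ) : ℝ :=
  4 * (sRepAmp (Real.sin (q 1 / 2) ^ 2) s - sRepAmp (Real.sin (q 0 / 2) ^ 2) s) ^ 2 - μ ^ 2

/-- Band-edge sheet function `P(q; μ; s) = 4(A₀(s) + A₁(s))² − μ²`.
[cite: RaghuKivelsonScalapino2010, §II (5)–(6)] -/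
def edgeSheet (μ : ℝ) (q : Momentum) (s : ℝ) : ℝ :=
  4 * (sRepAmp (Real.sin (q 0 / 2) ^ 2) s + sRepAmp (Real.sin (q 1 / 2) ^ 2) s) ^ 2 - μ ^ 2

/-- The Kohn sheet function at the fold equals `kohnSheetFold`.
[cite: RaghuKivelsonScalapino2010, §II (5)–(6)] -/
theorem kohnSheet_half (μ : ℝ) (q : Momentum) : kohnSheet μ q (1 / 2) = kohnSheetFold μ q := by
  simp only [kohnSheet, kohnSheetFold, sRepAmp_half_sin_sq]

/-- The band-edge sheet function at the fold equals `edgeSheetFold`.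
[cite: RaghuKivelsonScalapino2010, §II (5)–(6)] -/
theorem edgeSheet_half (μ : ℝ) (q : Momentum) : edgeSheet μ q (1 / 2) = edgeSheetFold μ q := by
  simp only [edgeSheet, edgeSheetFold, sRepAmp_half_sin_sq]

/-- `X(1 − s) = X(s)`. [cite: RaghuKivelsonScalapino2010, §II (5)–(6)] -/
theorem kohnSheet_symm (μ : ℝ) (q : Momentum) (s : ℝ) : kohnSheet μ q (1 - s) = kohnSheet μ q s := by
  simp only [kohnSheet, sRepAmp_symm]

/-- `P(1 − s) = P(s)`. [cite: RaghuKivelsonScalapino2010, §II (5)–(6)] -/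
theorem edgeSheet_symm (μ : ℝ) (q : Momentum) (s : ℝ) : edgeSheet μ q (1 - s) = edgeSheet μ q s := by
  simp only [edgeSheet, sRepAmp_symm]

/-- The band-edge sheet function is MINIMAL at the fold: `P₀ ≤ P(s)`; in particular `P₀ > 0` (no band-edge
crossing at the fold) implies none along the whole `s`-integral.
[cite: RaghuKivelsonScalapino2010, §II (5)–(6)] -/
theorem edgeSheetFold_le_edgeSheet (μ : ℝ) (q : Momentum) (s : ℝ) : edgeSheetFold μ q ≤ edgeSheet μ q s := by
  rw [← edgeSheet_half]
  unfold edgeSheet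
  have h0 := sRepAmp_half_le (sq_nonneg (Real.sin (q 0 / 2))) s
  have h1 := sRepAmp_half_le (sq_nonneg (Real.sin (q 1 / 2))) s
  have hn0 : 0 ≤ sRepAmp (Real.sin (q 0 / 2) ^ 2) (1 / 2) := Real.sqrt_nonneg _
  have hn1 : 0 ≤ sRepAmp (Real.sin (q 1 / 2) ^ 2) (1 / 2) := Real.sqrt_nonneg _
  nlinarith [mul_nonneg (add_nonneg (sub_nonneg.2 h0) (sub_nonneg.2 h1))
    (add_nonneg (add_nonneg hn0 hn1) (add_nonneg (hn0.trans h0) (hn1.trans h1)))]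

/-! ### (c) The elliptic parameters of the two DOS branches in sheet coordinates -/

/-- Inner branch: `1 − 16ab/P = X/P` (`X = 4(a−b)² − μ²`, `P = 4(a+b)² − μ²`). [folklore] -/
theorem one_sub_innerParam (a b μ : ℝ) (hP : 4 * (a + b) ^ 2 - μ ^ 2 ≠ 0) :
    1 - 16 * a * b / (4 * (a + b) ^ 2 - μ ^ 2) =
      (4 * (a - b) ^ 2 - μ ^ 2) / (4 * (a + b) ^ 2 - μ ^ 2) := by
  field_simp
  ring

/-- Outer branch: `1 − P/(16ab) = −X/(16ab)`. [folklore] -/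
theorem one_sub_outerParam (a b μ : ℝ) (_ha : a ≠ 0) (_hb : b ≠ 0) :
    1 - (4 * (a + b) ^ 2 - μ ^ 2) / (16 * a * b) = -(4 * (a - b) ^ 2 - μ ^ 2) / (16 * a * b) := by
  field_simp
  ring

end Summit.HubbardSuperconductivity.HubbardSuperconductivity.Theorems

end
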